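import Literature.NumberTheory.GaloisRepresentations.AbsIntegersEquiv
import Literature.NumberTheory.GaloisRepresentations.IdeleClassBarAbsoluteGaloisTransport
import Literature.NumberTheory.GaloisRepresentations.CohomologicalDimension
import Literature.NumberTheory.GaloisRepresentations.DecompositionGroupOfCompletion
import Literature.NumberTheory.GaloisRepresentations.IntegralGaloisActionProofs
import Literature.NumberTheory.EllipticCurves.GreenbergSelmer
import Literature.NumberTheory.Automorphic.AdicCompletionLocalField
import HarnessLib

/-!
# The four-term sequence of class field theory at a finite level, IX: the LAYER TRANSPORT — reading the
# level-`F` statements on the subgroup `G_F = Gal(K̄/F) ≤ Γ_K` through `IdeleClassBar.GalLayer.absGalEquiv`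

Cell `bsd-print-cf2` (HOME `run/shared/lean/pub/bsd-print-cf2/`), seat `bsd-line-cf2c-w6` g4, brick §4(d)
«four-term sequence `0 → Ē_∞ → U_v → 𝒳^{(v)} → A_∞ → 0` (CFT over `𝔎_∞L′`)» of LEAD memo
`Cruxes/SplitBadTwoRankOneOfFacts/RULING-B23-g13.md` §4, crux of record stmt-BirchSwinnertonDyer-24033
`PrintCf2RubinValueTwo.TwoVariableMainConjAtSplitTwoQuad`. Files I–VIII (g3) prove the finite-level four-term CFT
statements for a number field `F : Type` ON ITS OWN: its absolute Galois group `Γ_F = Gal(\bar F/F)` (`\bar F =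
AlgebraicClosure F`), its idèles, `[a, F] = ideleArtinMap F a`, its algebraic integers `\bar ℤ_F = absIntegers (𝓞 F) F`
and their primes/inertia groups. The (e)-assembler's Selmer groups live on subgroups of `Γ_K = Gal(K̄/K)` for the BASE
`K` (`subgroupH1`/`unramifiedOutside`/`datumSelmer` over `H ≤ Γ_K`, inertia `GreenbergSelmer.inertia v` and its
`Γ_K`-conjugates, `v` a place of `K`), the layers of the tower being `F n : IntermediateField K K̄` (ty2's
`SemilocalUnitData₂`). THIS file is the dictionary «(T-X)» of memo `Cruxes/TwoVariableMainConjAtSplitTwo/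
BRICK-D-FOURTERM-CFT-w6g3.md` §3/§7 between the two, for a finite Galois layer `E : IdeleClassBar.GalLayer K`
(`E.1 = F ⊆ K̄`), along the tree's `F`-LINEAR transport `E.absGalEquiv : G_F = Gal(K̄/F) ≃* Γ_F`
(`u ↦ θ ∘ u ∘ θ⁻¹`, `θ = E.closureEquiv : K̄ ≃ₐ[F] \bar F`):

* §1 `continuous_absGalEquiv`, `continuous_absGalEquiv_symm` — a homeomorphism (open kernels transport both ways);
* §2 the ring isomorphism `φ : \bar ℤ_K ≅ \bar ℤ_F` over `θ` (as `∃ φ` with GRAPH `(φ x : \bar F) = θ x`; no definition is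
  introduced): bijective, `G_F`-equivariant (`absIntegersHom_smul`), compatible with `𝓞 K → 𝓞 F`;
  **`absGalEquiv_mem_inertia_iff`: `absGalEquiv u ∈ I_𝔔(Γ_F) ↔ u ∈ I_{φ⁻¹𝔔}(Γ_K)`**; `φ⁻¹𝔔 ∣ w.under K` for `𝔔 ∣ w`
  and every `𝔓 ∣ v` is a `φ⁻¹𝔔`, `𝔔 ∣ w ∣ v` (`comap_absIntegersHom_mem_primesAbove`, `exists_comap_absIntegersHom_eq`);
* §3 **`forall_inertia_le_iff_forall_absGalEquiv_mem`**: «`N ≤ Γ_F` contains the inertia groups above every place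
  `w` of `F` not over `S₀`» ⟺ «`N` contains `absGalEquiv (G_F ∩ I_𝔓(Γ_K))` for every prime `𝔓` of `\bar ℤ_K` above a
  place `v ∉ S₀` of `K`»; `inertia_smul_eq_map_conj` (`I_{γ𝔓} = γ I_𝔓 γ⁻¹`), `greenbergSelmer_inertia_eq`
  (`GreenbergSelmer.inertia v = I_{𝔓₀}`, `𝔓₀ = adicCompletionPrime K v`) and **`forall_primesAbove_inertia_iff_forall_conj`**
  («all `I_𝔓`, `𝔓 ∣ v`» ⟺ «all `Γ_K`-conjugates of `GreenbergSelmer.inertia v`» = the `inertiaIn`/`conjH1` currency of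
  the Selmer side);
* the sequel file X (`…FourTermCFTLayerCharacters`) reads the two CHARACTER theorems of file VIII on `G_F ≤ Γ_K` through
  this dictionary (norm groups ⟺ characters of `G_F` with open kernel unramified outside the primes of `\bar ℤ_K` over
  `S₀`, tested on Artin lifts `u ∈ G_F`, `absGalEquiv u |_{F^ab} = [a, F]`).

Why `absGalEquiv` and not `absGaloisRestrict K F` (`ArtinRestriction`/`AbsIntegersEquiv`): the latter restricts along a
merely `K`-linear embedding `K̄ → \bar F`, which is `F`-linear only up to an element of `Gal(F/K)` and hence moves Artin
symbols in `Γ_F^ab`; `absGalEquiv` is conjugation by an `F`-isomorphism, canonical up to `G_F`-conjugation, under which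
restrictions to ABELIAN layers are invariant (the tree's `IdeleClassBar.absRestrictNormalHom_absGalEquiv`).

No `sorry`, no definition, no named fact; Theses-free. No summit statement is proved; BSD is not advanced here.

## References
* [NeukirchANT1999] J. Neukirch, *Algebraic Number Theory*, Ch. I §9 (9.1)–(9.6) (conjugate primes, inertia), Ch. IV §1
  (1.2) (Krull topology), Ch. VI (6.6).
* [CasselsFrohlichANT1967] J. Tate, Ch. VII §5.1 (B), 5.4, §11.1. [deShalit1987] Ch. III §1.1–1.3.
-/

noncomputable section

set_option linter.dupNamespace false -- D-0017: single-problem summit, `…BirchSwinnertonDyer.BirchSwinnertonDyer…` repeats a namespace by design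
set_option autoImplicit false

open Field NumberField IsDedekindDomain
open scoped Pointwise
open Literature.NumberTheory Literature.NumberTheory.NumberFields Literature.NumberTheory.GaloisRepresentations
  Literature.NumberTheory.GaloisRepresentations.IdeleClassBar

namespace Summit.BirchSwinnertonDyer.BirchSwinnertonDyer.Theorems.PrintCf2.FourTermCFT

/-! ### §1. `absGalEquiv : G_F ≃* Γ_F` is a homeomorphism -/

section Continuity

variable {F L : Type*} [Field F] [Field L] [Algebra F L] [Algebra.IsAlgebraic F L]
  (M : IntermediateField F L)

/-- **`M.fixingSubgroup → Gal(L/M)` is continuous** (Krull topologies; `L/F` algebraic): the preimage of `Gal(L/L')`,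
`L'/M` finite, contains `Gal(L/F(b)) ∩ Gal(L/M)` for an `M`-basis `b` of `L'`.
[cite: NeukirchANT1999, Ch. IV §1 Thm. (1.2)] -/
theorem continuous_fixingSubgroupEquiv :
    Continuous (IntermediateField.fixingSubgroupEquiv M : M.fixingSubgroup → (L ≃ₐ[M] L)) := by
  -- adapted from `Literature/AnabelianGeometry/EtaleTheta/GKCyclotomeJunction.lean` (not imported: unrelated topic)
  apply continuous_of_continuousAt_one _ (continuousAt_def.mpr _)
  intro N hN
  rw [map_one] at hN
  obtain ⟨L', hLfd, hL⟩ := (krullTopology_mem_nhds_one_iff M L N).mp hN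
  haveI := hLfd
  let b := Module.finBasis M L'
  let S : Set L := Set.range fun i => ((b i : L') : L)
  let M' : IntermediateField F L := IntermediateField.adjoin F S
  haveI : FiniteDimensional F M' :=
    IntermediateField.finiteDimensional_adjoin fun x _ => (Algebra.IsAlgebraic.isAlgebraic x).isIntegral
  have hopen : IsOpen (Subtype.val ⁻¹' (M'.fixingSubgroup : Set (L ≃ₐ[F] L)) : Set M.fixingSubgroup) :=
    M'.fixingSubgroup_isOpen.preimage continuous_subtype_val
  refine Filter.mem_of_superset (hopen.mem_nhds (by simp)) fun σ hσ => hL ?_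
  rw [Set.mem_preimage, SetLike.mem_coe, IntermediateField.mem_fixingSubgroup_iff] at hσ
  rw [SetLike.mem_coe, IntermediateField.mem_fixingSubgroup_iff]
  have hb : ∀ i, (IntermediateField.fixingSubgroupEquiv M σ).toLinearMap ((b i : L') : L) = (b i : L') :=
    fun i => hσ _ (IntermediateField.subset_adjoin F S ⟨i, rfl⟩)
  have key : (IntermediateField.fixingSubgroupEquiv M σ).toLinearMap ∘ₗ L'.val.toLinearMap =
      L'.val.toLinearMap := b.ext fun i => hb i
  intro x hx
  exact congr($key ⟨x, hx⟩)

/-- **`Gal(L/M) → M.fixingSubgroup ≤ Gal(L/F)` is continuous** (restriction of scalars): the preimage of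
`Gal(L/L') ∩ Gal(L/M)`, `L'/F` finite, contains `Gal(L/M(b))` for an `F`-basis `b` of `L'`.
[cite: NeukirchANT1999, Ch. IV §1 Thm. (1.2)] -/
theorem continuous_fixingSubgroupEquiv_symm :
    Continuous ((IntermediateField.fixingSubgroupEquiv M).symm : (L ≃ₐ[M] L) → M.fixingSubgroup) := by
  refine Continuous.subtype_mk ?_ _
  let φ : (L ≃ₐ[M] L) →* (L ≃ₐ[F] L) :=
    { toFun := fun ψ => ((IntermediateField.fixingSubgroupEquiv M).symm ψ : M.fixingSubgroup)
      map_one' := by rw [map_one]; rfl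
      map_mul' := fun _ _ => by rw [map_mul]; rfl }
  change Continuous φ
  apply continuous_of_continuousAt_one φ (continuousAt_def.mpr _)
  intro N hN
  rw [map_one] at hN
  obtain ⟨L', hLfd, hL⟩ := (krullTopology_mem_nhds_one_iff F L N).mp hN
  haveI := hLfd
  let b := Module.finBasis F L'
  let S : Set L := Set.range fun i => ((b i : L') : L)
  let M' : IntermediateField M L := IntermediateField.adjoin M S
  haveI : FiniteDimensional M M' :=
    IntermediateField.finiteDimensional_adjoin fun x _ =>
      ((Algebra.IsAlgebraic.isAlgebraic (R := F) x).tower_top M).isIntegral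
  refine Filter.mem_of_superset (M'.fixingSubgroup_isOpen.mem_nhds (one_mem _)) fun ψ hψ => hL ?_
  rw [SetLike.mem_coe, IntermediateField.mem_fixingSubgroup_iff] at hψ
  rw [SetLike.mem_coe, IntermediateField.mem_fixingSubgroup_iff]
  have hb : ∀ i, (φ ψ).toLinearMap ((b i : L') : L) = (b i : L') :=
    fun i => hψ _ (IntermediateField.subset_adjoin M S ⟨i, rfl⟩)
  have key : (φ ψ).toLinearMap ∘ₗ L'.val.toLinearMap = L'.val.toLinearMap := b.ext fun i => hb i
  intro x hx
  exact congr($key ⟨x, hx⟩)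

end Continuity

variable {K : Type} [Field K] (E : GalLayer K)

/-- **`absGalEquiv : G_F → Γ_F` is continuous** (`fixingSubgroupEquiv`, then conjugation by `θ`, the tree's
`continuous_autCongr`). [cite: NeukirchANT1999, Ch. IV §1 Thm. (1.2)] [cite: CasselsFrohlichANT1967, Ch. VII §11.1] -/
theorem continuous_absGalEquiv : Continuous E.absGalEquiv :=
  (continuous_autCongr E.closureEquiv).comp (continuous_fixingSubgroupEquiv E.1)

/-- **`absGalEquiv⁻¹ : Γ_F → G_F` is continuous** — so `absGalEquiv` is a homeomorphism and a subgroup of `G_F`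
(subspace topology from `Γ_K`) is open iff its image in `Γ_F` is. [cite: NeukirchANT1999, Ch. IV §1 Thm. (1.2)] -/
theorem continuous_absGalEquiv_symm : Continuous E.absGalEquiv.symm :=
  (continuous_fixingSubgroupEquiv_symm (F := K) E.1).comp (continuous_autCongr E.closureEquiv.symm)

/-! ### §2. `\bar ℤ_K ≅ \bar ℤ_F` over `θ`, primes and inertia groups -/

/-- The action of `absGalEquiv u` on `\bar F`: `(θuθ⁻¹)(y) = θ(u(θ⁻¹ y))`. [cite: CasselsFrohlichANT1967, Ch. VII §11.1] -/
theorem absGalEquiv_smul (u : (E.openNormalSubgroup : Subgroup (absoluteGaloisGroup K)))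
    (y : AlgebraicClosure E.1) :
    E.absGalEquiv u • y = E.closureEquiv ((u : absoluteGaloisGroup K) • E.closureEquiv.symm y) := by
  rw [absoluteGaloisGroup.smul_def, GalLayer.toAlgEquiv_absGalEquiv, AlgEquiv.autCongr_apply,
    AlgEquiv.trans_apply, AlgEquiv.trans_apply, GalLayer.fixingSubgroupEquiv_apply]

/-- `(θuθ⁻¹)(θ x) = θ(u x)`. [cite: CasselsFrohlichANT1967, Ch. VII §11.1] -/
theorem absGalEquiv_smul_closureEquiv (u : (E.openNormalSubgroup : Subgroup (absoluteGaloisGroup K)))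
    (x : AlgebraicClosure K) :
    E.absGalEquiv u • E.closureEquiv x = E.closureEquiv ((u : absoluteGaloisGroup K) • x) := by
  rw [absGalEquiv_smul, AlgEquiv.symm_apply_apply]

/-- `θ` maps algebraic integers to algebraic integers (integrality over `ℤ` is preserved by ring maps).
[cite: NeukirchANT1999, Ch. I §9] -/
theorem closureEquiv_mem_absIntegers (x : absIntegers (𝓞 K) K) :
    E.closureEquiv (x : AlgebraicClosure K) ∈ absIntegers (𝓞 E.1) E.1 := by
  have hx : IsIntegral ℤ (x : AlgebraicClosure K) := isIntegral_trans (R := ℤ) (A := 𝓞 K) _ x.2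
  exact (map_isIntegral_int (E.closureEquiv : AlgebraicClosure K →+* AlgebraicClosure E.1) hx).tower_top

/-- **The ring homomorphism `φ : \bar ℤ_K → \bar ℤ_F` over `θ` exists** (it is `θ` restricted; stated as `∃` with its
graph so that no definition is introduced — every statement below takes such a `φ` as a parameter).
[cite: NeukirchANT1999, Ch. I §9] -/
theorem exists_absIntegersHom :
    ∃ φ : absIntegers (𝓞 K) K →+* absIntegers (𝓞 E.1) E.1,
      ∀ x, ((φ x : absIntegers (𝓞 E.1) E.1) : AlgebraicClosure E.1) = E.closureEquiv (x : AlgebraicClosure K) :=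
  ⟨((E.closureEquiv : AlgebraicClosure K →+* AlgebraicClosure E.1).comp
      (absIntegers (𝓞 K) K).val.toRingHom).codRestrict (absIntegers (𝓞 E.1) E.1)
      (closureEquiv_mem_absIntegers E), fun _ => rfl⟩

variable {E} {φ : absIntegers (𝓞 K) K →+* absIntegers (𝓞 E.1) E.1}
  (hφ : ∀ x, ((φ x : absIntegers (𝓞 E.1) E.1) : AlgebraicClosure E.1) = E.closureEquiv (x : AlgebraicClosure K))
include hφ

/-- `φ` is bijective (`θ` is, and integrality over `ℤ` is detected after `θ⁻¹`). [cite: NeukirchANT1999, Ch. I §9] -/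
theorem absIntegersHom_bijective : Function.Bijective φ := by
  refine ⟨fun x y h => Subtype.ext (E.closureEquiv.injective ?_), fun y => ?_⟩
  · rw [← hφ, ← hφ, h]
  · have hy : IsIntegral ℤ (y : AlgebraicClosure E.1) := isIntegral_trans (R := ℤ) (A := 𝓞 E.1) _ y.2
    have h1 : IsIntegral ℤ (E.closureEquiv.symm (y : AlgebraicClosure E.1)) :=
      map_isIntegral_int (E.closureEquiv.symm : AlgebraicClosure E.1 →+* AlgebraicClosure K) hy
    refine ⟨⟨E.closureEquiv.symm y, h1.tower_top⟩, Subtype.ext ?_⟩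
    rw [hφ]
    exact E.closureEquiv.apply_symm_apply _

/-- **Equivariance**: `φ (u • x) = absGalEquiv u • φ x` for `u ∈ G_F`. [cite: NeukirchANT1999, Ch. I §9] -/
theorem absIntegersHom_smul (u : (E.openNormalSubgroup : Subgroup (absoluteGaloisGroup K)))
    (x : absIntegers (𝓞 K) K) :
    φ ((u : absoluteGaloisGroup K) • x) = E.absGalEquiv u • φ x := by
  apply Subtype.ext
  rw [hφ]
  change E.closureEquiv ((u : absoluteGaloisGroup K) • (x : AlgebraicClosure K)) =
    E.absGalEquiv u • ((φ x : absIntegers (𝓞 E.1) E.1) : AlgebraicClosure E.1)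
  rw [hφ, absGalEquiv_smul_closureEquiv]

/-- Compatibility with the structure maps: `φ ∘ (𝓞 K → \bar ℤ_K) = (𝓞 F → \bar ℤ_F) ∘ (𝓞 K → 𝓞 F)` (`θ` is `F`-, hence
`K`-linear). [cite: NeukirchANT1999, Ch. I §9] -/
theorem absIntegersHom_algebraMap (r : 𝓞 K) :
    φ (algebraMap (𝓞 K) (absIntegers (𝓞 K) K) r) =
      algebraMap (𝓞 E.1) (absIntegers (𝓞 E.1) E.1) (algebraMap (𝓞 K) (𝓞 E.1) r) := by
  apply Subtype.ext
  rw [hφ]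
  change E.closureEquiv (algebraMap (𝓞 K) (AlgebraicClosure K) r) =
    algebraMap (𝓞 E.1) (AlgebraicClosure E.1) (algebraMap (𝓞 K) (𝓞 E.1) r)
  rw [IsScalarTower.algebraMap_apply (𝓞 K) K (AlgebraicClosure K),
    IsScalarTower.algebraMap_apply K E.1 (AlgebraicClosure K), AlgEquiv.commutes,
    IsScalarTower.algebraMap_apply (𝓞 E.1) E.1 (AlgebraicClosure E.1),
    ← IsScalarTower.algebraMap_apply (𝓞 K) (𝓞 E.1) E.1, IsScalarTower.algebraMap_apply (𝓞 K) K E.1]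

/-- **INERTIA TRANSPORT: `absGalEquiv u ∈ I_𝔔(Γ_F) ↔ u ∈ I_{φ⁻¹𝔔}(Γ_K)`** for every ideal `𝔔` of `\bar ℤ_F` and
`u ∈ G_F` (`I = {σ | σx ≡ x}`, read through the equivariant bijection `φ`). [cite: NeukirchANT1999, Ch. I §9 (9.4)–(9.6)] -/
theorem absGalEquiv_mem_inertia_iff (𝔔 : Ideal (absIntegers (𝓞 E.1) E.1))
    (u : (E.openNormalSubgroup : Subgroup (absoluteGaloisGroup K))) :
    E.absGalEquiv u ∈ 𝔔.inertia (absoluteGaloisGroup E.1) ↔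
      (u : absoluteGaloisGroup K) ∈ (𝔔.comap φ).inertia (absoluteGaloisGroup K) := by
  rw [Ideal.inertia, Ideal.inertia, AddSubgroup.mem_inertia, AddSubgroup.mem_inertia]
  constructor
  · intro h x
    rw [Submodule.mem_toAddSubgroup, Ideal.mem_comap, map_sub, absIntegersHom_smul hφ]
    exact h _
  · intro h z
    obtain ⟨x, rfl⟩ := (absIntegersHom_bijective hφ).2 z
    have hx := h x
    rw [Submodule.mem_toAddSubgroup, Ideal.mem_comap, map_sub, absIntegersHom_smul hφ] at hx
    exact hx

/-- `(φ⁻¹𝔔) ∩ 𝓞 K = (𝔔 ∩ 𝓞 F) ∩ 𝓞 K`. [cite: NeukirchANT1999, Ch. I §9] -/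
theorem under_comap_absIntegersHom [NumberField E.1] (𝔔 : Ideal (absIntegers (𝓞 E.1) E.1)) :
    (𝔔.comap φ).under (𝓞 K) = (𝔔.under (𝓞 E.1)).comap (algebraMap (𝓞 K) (𝓞 E.1)) := by
  change Ideal.comap (algebraMap (𝓞 K) (absIntegers (𝓞 K) K)) (Ideal.comap φ 𝔔) =
    Ideal.comap (algebraMap (𝓞 K) (𝓞 E.1)) (Ideal.comap (algebraMap (𝓞 E.1) (absIntegers (𝓞 E.1) E.1)) 𝔔)
  rw [Ideal.comap_comap, Ideal.comap_comap]
  congr 1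
  exact RingHom.ext fun r => absIntegersHom_algebraMap hφ r

/-- **`𝔔 ∣ w ⟹ φ⁻¹𝔔 ∣ w.under K`**: the pull-back of a prime of `\bar ℤ_F` above the place `w` of `F` lies above the
place of `K` below `w`. [cite: NeukirchANT1999, Ch. I §9] -/
theorem comap_absIntegersHom_mem_primesAbove [NumberField E.1] {w : HeightOneSpectrum (𝓞 E.1)}
    {𝔔 : Ideal (absIntegers (𝓞 E.1) E.1)} (h𝔔 : 𝔔 ∈ w.primesAbove) :
    𝔔.comap φ ∈ (w.under (𝓞 K)).primesAbove := by
  haveI := h𝔔.1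
  refine ⟨Ideal.comap_isPrime _ 𝔔, ⟨?_⟩⟩
  rw [under_comap_absIntegersHom hφ, ← h𝔔.2.over]
  rfl

/-- **Every prime `𝔓 ∣ v` of `\bar ℤ_K` is `φ⁻¹𝔔` for a prime `𝔔 ∣ w` of `\bar ℤ_F` above a place `w ∣ v` of `F`**
(`𝔔 = φ(𝔓)`, `w = 𝔔 ∩ 𝓞 F`). [cite: NeukirchANT1999, Ch. I §9] -/
theorem exists_comap_absIntegersHom_eq [NumberField E.1] {v : HeightOneSpectrum (𝓞 K)}
    {𝔓 : Ideal (absIntegers (𝓞 K) K)} (h𝔓 : 𝔓 ∈ v.primesAbove) :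
    ∃ (w : HeightOneSpectrum (𝓞 E.1)) (𝔔 : Ideal (absIntegers (𝓞 E.1) E.1)),
      w.under (𝓞 K) = v ∧ 𝔔 ∈ w.primesAbove ∧ 𝔔.comap φ = 𝔓 := by
  haveI := h𝔓.1
  let e : absIntegers (𝓞 K) K ≃+* absIntegers (𝓞 E.1) E.1 :=
    RingEquiv.ofBijective φ (absIntegersHom_bijective hφ)
  let 𝔔 : Ideal (absIntegers (𝓞 E.1) E.1) :=
    𝔓.comap (e.symm : absIntegers (𝓞 E.1) E.1 →+* absIntegers (𝓞 K) K)
  have h𝔔𝔓 : 𝔔.comap φ = 𝔓 := by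
    ext x
    rw [Ideal.mem_comap, Ideal.mem_comap]
    change e.symm (e x) ∈ 𝔓 ↔ x ∈ 𝔓
    rw [e.symm_apply_apply]
  haveI h𝔔p : 𝔔.IsPrime := Ideal.comap_isPrime _ 𝔓
  have hv : (𝔔.under (𝓞 E.1)).comap (algebraMap (𝓞 K) (𝓞 E.1)) = v.asIdeal := by
    rw [← under_comap_absIntegersHom hφ, h𝔔𝔓, ← h𝔓.2.over]
  have hne : 𝔔.under (𝓞 E.1) ≠ ⊥ := by
    intro h0
    apply v.ne_bot
    rw [← hv, h0, Ideal.comap_bot_of_injective]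
    exact FaithfulSMul.algebraMap_injective (𝓞 K) (𝓞 E.1)
  exact ⟨⟨𝔔.under (𝓞 E.1), Ideal.IsPrime.under (𝓞 E.1) 𝔔, hne⟩, 𝔔, HeightOneSpectrum.ext hv,
    ⟨h𝔔p, ⟨rfl⟩⟩, h𝔔𝔓⟩

/-! ### §3. The dictionary of «unramified outside `S₀`» conditions -/

/-- **«`N` contains the inertia groups of `Γ_F` above every place of `F` not over `S₀`» ⟺ «`N` contains
`absGalEquiv (G_F ∩ I_𝔓(Γ_K))` for every prime `𝔓` of `\bar ℤ_K` above a place `v ∉ S₀` of `K`»** (for a given `φ`;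
`I_𝔓(G_F) = G_F ∩ I_𝔓(Γ_K)`). [cite: NeukirchANT1999, Ch. I §9 (9.4)–(9.6)] -/
theorem forall_inertia_le_iff_forall_absGalEquiv_mem_of [NumberField E.1] (S₀ : Set (HeightOneSpectrum (𝓞 K)))
    (N : Subgroup (absoluteGaloisGroup E.1)) :
    (∀ w : HeightOneSpectrum (𝓞 E.1), w.under (𝓞 K) ∉ S₀ →
      ∀ 𝔔 ∈ w.primesAbove, 𝔔.inertia (absoluteGaloisGroup E.1) ≤ N) ↔
    (∀ v : HeightOneSpectrum (𝓞 K), v ∉ S₀ → ∀ 𝔓 ∈ v.primesAbove,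
      ∀ u : (E.openNormalSubgroup : Subgroup (absoluteGaloisGroup K)),
        (u : absoluteGaloisGroup K) ∈ 𝔓.inertia (absoluteGaloisGroup K) → E.absGalEquiv u ∈ N) := by
  constructor
  · intro h v hv 𝔓 h𝔓 u hu
    obtain ⟨w, 𝔔, hwv, h𝔔, h𝔔𝔓⟩ := exists_comap_absIntegersHom_eq hφ h𝔓
    refine h w (hwv ▸ hv) 𝔔 h𝔔 ((absGalEquiv_mem_inertia_iff hφ 𝔔 u).2 ?_)
    rwa [h𝔔𝔓]
  · intro h w hw 𝔔 h𝔔 γ hγ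
    obtain ⟨u, rfl⟩ := E.absGalEquiv.surjective γ
    exact h (w.under (𝓞 K)) hw _ (comap_absIntegersHom_mem_primesAbove hφ h𝔔) u
      ((absGalEquiv_mem_inertia_iff hφ 𝔔 u).1 hγ)

omit hφ

/-- **THE DICTIONARY** (φ-free form of the previous theorem): «`N ≤ Γ_F` contains the inertia groups above every
place `w` of `F` with `w.under K ∉ S₀`» ⟺ «for every place `v ∉ S₀` of `K`, every prime `𝔓 ∣ v` of `\bar ℤ_K` and every
`u ∈ G_F ∩ I_𝔓(Γ_K)`, `absGalEquiv u ∈ N`». With `N = ker χ` this converts the hypothesis «`χ` unramified outside `S`»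
of file VIII (`S` = the places of `F` over `S₀`) into the `Γ_K`-currency. [cite: NeukirchANT1999, Ch. I §9 (9.4)–(9.6)] -/
theorem forall_inertia_le_iff_forall_absGalEquiv_mem [NumberField E.1] (S₀ : Set (HeightOneSpectrum (𝓞 K)))
    (N : Subgroup (absoluteGaloisGroup E.1)) :
    (∀ w : HeightOneSpectrum (𝓞 E.1), w.under (𝓞 K) ∉ S₀ →
      ∀ 𝔔 ∈ w.primesAbove, 𝔔.inertia (absoluteGaloisGroup E.1) ≤ N) ↔
    (∀ v : HeightOneSpectrum (𝓞 K), v ∉ S₀ → ∀ 𝔓 ∈ v.primesAbove,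
      ∀ u : (E.openNormalSubgroup : Subgroup (absoluteGaloisGroup K)),
        (u : absoluteGaloisGroup K) ∈ 𝔓.inertia (absoluteGaloisGroup K) → E.absGalEquiv u ∈ N) := by
  obtain ⟨φ, hφ⟩ := exists_absIntegersHom E
  exact forall_inertia_le_iff_forall_absGalEquiv_mem_of hφ S₀ N

/-- **Inertia groups of conjugate primes are conjugate: `I_{γ𝔓} = γ I_𝔓 γ⁻¹`** (in `Γ_K`).
[cite: NeukirchANT1999, Ch. I §9 (9.4)] -/
theorem inertia_smul_eq_map_conj (γ : absoluteGaloisGroup K) (𝔓 : Ideal (absIntegers (𝓞 K) K)) :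
    (γ • 𝔓).inertia (absoluteGaloisGroup K) =
      (𝔓.inertia (absoluteGaloisGroup K)).map (MulAut.conj γ).toMonoidHom := by
  -- adapted from the private `absIntegers_inertia_smul_eq_map_conj` of `NumberFields/ArtinMapDecompositionInertia`
  ext σ
  rw [Subgroup.mem_map_equiv, Ideal.inertia, Ideal.inertia, AddSubgroup.mem_inertia,
    AddSubgroup.mem_inertia, MulAut.conj_symm_apply]
  constructor
  · intro h x
    have h1 := h (γ • x)
    rw [Submodule.mem_toAddSubgroup, Ideal.mem_pointwise_smul_iff_inv_smul_mem, smul_sub,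
      inv_smul_smul, smul_smul, smul_smul] at h1
    exact h1
  · intro h x
    have h1 := h (γ⁻¹ • x)
    rw [Submodule.mem_toAddSubgroup, Ideal.mem_pointwise_smul_iff_inv_smul_mem, smul_sub,
      smul_smul]
    rwa [smul_smul, mul_inv_cancel_right, Submodule.mem_toAddSubgroup] at h1

/-- **`GreenbergSelmer.inertia v = I_{𝔓₀}(Γ_K)`** for the prime `𝔓₀ = adicCompletionPrime K v` of the chosen embedding
`K̄ → \bar K_v` (the tree's `inertia_adicCompletionPrime_eq_map_absInertia`, Neukirch II (9.6)): the Selmer side's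
inertia group IS an inertia group of a prime of `\bar ℤ_K`. [cite: NeukirchANT1999, Ch. II §9 Prop. (9.6)] -/
theorem greenbergSelmer_inertia_eq [NumberField K] (v : HeightOneSpectrum (𝓞 K)) :
    EllipticCurves.GreenbergSelmer.inertia v = (adicCompletionPrime K v).inertia (absoluteGaloisGroup K) := by
  rw [inertia_adicCompletionPrime_eq_map_absInertia]
  rfl

/-- **«all inertia groups `I_𝔓(Γ_K)`, `𝔓 ∣ v`» ⟺ «all `Γ_K`-conjugates of `GreenbergSelmer.inertia v`»** for any
predicate `P` on `Γ_K` (`Γ_K` permutes the primes above `v` transitively, the tree's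
`exists_smul_eq_of_mem_primesAbove_holds`, and `I_{σ𝔓₀} = σ I_{𝔓₀} σ⁻¹`): the `primesAbove` currency of files VIII/IX
equals the `inertiaIn H v` + `conjH1 σ` currency of `unramifiedOutside`/`datumSelmer`.
[cite: NeukirchANT1999, Ch. I §9 Prop. (9.1), Ch. II §9 Prop. (9.6)] -/
theorem forall_primesAbove_inertia_iff_forall_conj [NumberField K] (v : HeightOneSpectrum (𝓞 K))
    (P : absoluteGaloisGroup K → Prop) :
    (∀ 𝔓 ∈ v.primesAbove, ∀ g ∈ 𝔓.inertia (absoluteGaloisGroup K), P g) ↔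
      ∀ (σ : absoluteGaloisGroup K), ∀ g ∈ EllipticCurves.GreenbergSelmer.inertia v, P (σ * g * σ⁻¹) := by
  rw [greenbergSelmer_inertia_eq]
  constructor
  · intro h σ g hg
    refine h (σ • adicCompletionPrime K v)
      (smul_mem_primesAbove (adicCompletionPrime_mem_primesAbove K v) σ) _ ?_
    rw [inertia_smul_eq_map_conj, Subgroup.mem_map]
    exact ⟨g, hg, rfl⟩
  · intro h 𝔓 h𝔓 g hg
    obtain ⟨σ, hσ⟩ := HeightOneSpectrum.exists_smul_eq_of_mem_primesAbove_holds
      (adicCompletionPrime_mem_primesAbove K v) h𝔓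
    rw [← hσ, inertia_smul_eq_map_conj, Subgroup.mem_map] at hg
    obtain ⟨g₀, hg₀, rfl⟩ := hg
    exact h σ g₀ hg₀

end Summit.BirchSwinnertonDyer.BirchSwinnertonDyer.Theorems.PrintCf2.FourTermCFT

end
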